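import Summits.QuantumFields.YangMills.Theorems.LuscherReductionDressedRitzPolyakovLiftDressed
import Summits.QuantumFields.YangMills.Theorems.LuscherReductionDressedRitzPolyakovLiftStaticsDoublet
import HarnessLib

/-!
# Line «polyakovlift» r3 on crux `DressedRitz` (stmt-QuantumFields-20205), stub S-STAT `stub_liftStatics` (DRESSED family):
# the dressed covariance form `(f, h) ↦ ⟨K_β^m u_f, K_β^m u_h⟩` is `S₃`-invariant and bilinear — symmetry zeros of clause (o2) survive time-dressing

Fleet-service module of seat ym-infvol-p1 g5 (route `LuscherReduction`, femto rung R2b1).  Skeleton of record r3 `11209be61e7d2ff5` (lead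
ym-lead-20205-polyakovlift g0, 2026-08-27T12:04Z): the stub texts are r2's with `liftFamily ↦ dressedLiftFamily`,
`dressedLiftFamily β φ g i = K_β^[dressSteps L] (OpPlat.ins φ (flowLiftAt 0 (flowTime β L) (g i)))` (tree `…PolyakovLiftDressed.lean`, p529179, where
(o0) for the dressed family is already `PolyakovLift.dressedLiftFamily_o0`).  This file transports the EXACT part of clause (o2) — the symmetry
zeros of `…PolyakovLiftStaticsSymmetry.lean` (p528682) and `…StaticsDoublet.lean` — to the dressed family:

* §1 `iterate_transferApply_comp_configPerm`, `iterate_transferApply_lincomb`, `l2_iterate_left_right` — `K_β^m` commutes with axis permutations,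
  is linear on physical vectors, and `⟨K^i a, K^j b⟩ = ⟨K^{i+j} a, b⟩`;
* §2 `ins_flowLiftAt_comp_configPerm_eq` (`u_{f∘P} = u_f ∘ P` for a raw vacuum), ★ `dressedLiftVec_comp_configPerm`, ★ `l2_dressedLiftVec_comp_configPerm`
  — the dressed covariance form is `S₃`-INVARIANT; `dressedLiftVec_lincomb` — and LINEAR in the one-site function;
* §3 `sum_weight_l2_dressedLiftVec_eq_zero` (averaging), ★ `l2_dressedLiftVec_eq_zero_of_invariant`, ★ `l2_dressedLiftVec_eq_zero_of_sign` —
  `⟨u'_f, u'_h⟩ = 0` EXACTLY for `S₃`-invariant (resp. sign-type) `f` against `h` of vanishing (resp. sign-twisted) `S₃`-average — every raw vacuum,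
  every dressing depth, every `L`, every `β`.

Companion `…StaticsDressedResidual.lean`: the doublet lemma for the dressed form and the r3-text packaging (`stub_liftStatics` at `k ≤ 1`, the
exact residual `(o2) ⟹ Stmt.stub_liftStatics`).  HONEST FRAMING: exact symmetry bookkeeping at fixed lattice on the CONDITIONAL femto rung R2b1;
nothing about the renormalisation-group estimate for same-sector pairs; nothing here bears on infinite volume, the continuum limit or the Clay gap.
References: M. Lüscher, NPB 219 (1983) 233, §2 [cite: Luscher1983, §2]; M. Lüscher, U. Wolff, NPB 339 (1990) 222 [cite: LuscherWolff1990].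
-/

set_option autoImplicit false

noncomputable section

open MeasureTheory Filter Topology
open Literature.MathematicalPhysics.QuantumFieldTheory
open Literature.MathematicalPhysics.QuantumLattice
open scoped BigOperators

namespace Summit.QuantumFields.YangMills.Theorems.FemtoTransferGap.PolyakovLift

open Summit.QuantumFields.YangMills.Theorems.FemtoTransferGap

/-! ## §1 Powers of the transfer operator: equivariance, linearity, symmetry -/

section Iterate

variable {L : ℕ} [NeZero L]

/-- `K_β^m (ψ ∘ P) = (K_β^m ψ) ∘ P` for an axis permutation `P` (`transferApply_comp_configPerm`, induction). [cite: Luscher1983, §2] -/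
theorem iterate_transferApply_comp_configPerm (β : ℝ) (π : Equiv.Perm (Fin 3)) (ψ : GaugeConfig 3 L SU2 → ℝ) :
    ∀ m : ℕ, (transferApply (L := L) β)^[m] (fun U => ψ (configPerm π U)) = fun U => (transferApply β)^[m] ψ (configPerm π U)
  | 0 => rfl
  | m + 1 => by
    rw [Function.iterate_succ_apply', iterate_transferApply_comp_configPerm β π ψ m, transferApply_comp_configPerm,
      ← Function.iterate_succ_apply' (transferApply β) m ψ]

/-- `K_β^m (aψ + bψ') = a K_β^m ψ + b K_β^m ψ'` on physical test functions. [folklore] -/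
theorem iterate_transferApply_lincomb (β : ℝ) {ψ ψ' : GaugeConfig 3 L SU2 → ℝ} (hψ : IsPhys ψ) (hψ' : IsPhys ψ') (a b : ℝ) :
    ∀ m : ℕ, (transferApply (L := L) β)^[m] (a • ψ + b • ψ') = a • (transferApply β)^[m] ψ + b • (transferApply β)^[m] ψ'
  | 0 => rfl
  | m + 1 => by
    rw [Function.iterate_succ_apply', iterate_transferApply_lincomb β hψ hψ' a b m,
      transferApply_add β ((isPhys_iterate_transferApply β hψ m).smul a) ((isPhys_iterate_transferApply β hψ' m).smul b),
      transferApply_smul, transferApply_smul, ← Function.iterate_succ_apply' (transferApply β) m ψ,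
      ← Function.iterate_succ_apply' (transferApply β) m ψ']

/-- `⟨K^i a, K^j b⟩ = ⟨K^{i+j} a, b⟩` for physical `a, b` (symmetry of `K_β`). [folklore] -/
theorem l2_iterate_left_right (β : ℝ) {a b : GaugeConfig 3 L SU2 → ℝ} (ha : IsPhys a) (hb : IsPhys b) :
    ∀ (j i : ℕ), l2 ((transferApply (L := L) β)^[i] a) ((transferApply β)^[j] b) = l2 ((transferApply β)^[i + j] a) b
  | 0, i => by simp
  | j + 1, i => by
    rw [Function.iterate_succ_apply', ← l2_transferApply_comm β (isPhys_iterate_transferApply β ha i) (isPhys_iterate_transferApply β hb j),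
      ← Function.iterate_succ_apply' (transferApply β) i a, l2_iterate_left_right β ha hb j (i + 1)]
    congr 2
    omega

end Iterate

/-! ## §2 The dressed channel map is `S₃`-equivariant and linear; the dressed covariance form is invariant -/

section Dressed

variable {L : ℕ} [NeZero L]

/-- **`u_{f∘P} = u_f ∘ P`** for a raw vacuum `φ`: the channel vector of the permuted one-site function is the permuted channel vector (flowed lift
equivariant, vacuum expectation invariant, `φ ∘ P = φ`). [cite: Luscher1983, §2] -/
theorem ins_flowLiftAt_comp_configPerm_eq (β : ℝ) {φ : GaugeConfig 3 L SU2 → ℝ} (hφ : IsPhys φ)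
    (heig : transferApply β φ = levelValue su2Rep L β 0 • φ) (π : Equiv.Perm (Fin 3)) (t : ℝ) (f : GaugeConfig 3 1 SU2 → ℝ) :
    OpPlat.ins φ (flowLiftAt 0 t fun V => f (configPerm π V)) = fun U => OpPlat.ins φ (flowLiftAt 0 t f) (configPerm π U) := by
  have hvev := l2_vac_flowLiftAt_comp_configPerm β hφ heig π t f
  funext U
  simp only [OpPlat.ins, Pi.mul_apply, Pi.sub_apply, hvev, rawVacuum_comp_configPerm β hφ heig π U, flowLiftAt_zero_configPerm]

/-- ★ **The dressed lifted vector is `S₃`-equivariant**: `u'_{f∘P} = u'_f ∘ P` (`K_β^m` commutes with `P`). [cite: Luscher1983, §2] -/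
theorem dressedLiftVec_comp_configPerm (β : ℝ) {φ : GaugeConfig 3 L SU2 → ℝ} (hφ : IsPhys φ)
    (heig : transferApply β φ = levelValue su2Rep L β 0 • φ) (π : Equiv.Perm (Fin 3)) (f : GaugeConfig 3 1 SU2 → ℝ) :
    dressedLiftVec β φ (fun V => f (configPerm π V)) = fun U => dressedLiftVec β φ f (configPerm π U) := by
  unfold dressedLiftVec liftVec
  rw [ins_flowLiftAt_comp_configPerm_eq β hφ heig π, iterate_transferApply_comp_configPerm]

/-- ★ **The dressed covariance form is `S₃`-invariant**: `⟨u'_{f∘P}, u'_{h∘P}⟩ = ⟨u'_f, u'_h⟩` for every raw vacuum. [cite: Luscher1983, §2] -/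
theorem l2_dressedLiftVec_comp_configPerm (β : ℝ) {φ : GaugeConfig 3 L SU2 → ℝ} (hφ : IsPhys φ)
    (heig : transferApply β φ = levelValue su2Rep L β 0 • φ) (π : Equiv.Perm (Fin 3)) (f h : GaugeConfig 3 1 SU2 → ℝ) :
    l2 (dressedLiftVec β φ fun V => f (configPerm π V)) (dressedLiftVec β φ fun V => h (configPerm π V)) =
      l2 (dressedLiftVec β φ f) (dressedLiftVec β φ h) := by
  rw [dressedLiftVec_comp_configPerm β hφ heig, dressedLiftVec_comp_configPerm β hφ heig, l2_comp_configPerm]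

/-- **The dressed channel map is linear** in the one-site function (physical `φ, f, h`). [folklore] -/
theorem dressedLiftVec_lincomb (β : ℝ) {φ : GaugeConfig 3 L SU2 → ℝ} (hφ : IsPhys φ) (a b : ℝ)
    {f h : GaugeConfig 3 1 SU2 → ℝ} (hf : IsPhys f) (hh : IsPhys h) :
    dressedLiftVec β φ (fun V => a * f V + b * h V) = a • dressedLiftVec β φ f + b • dressedLiftVec β φ h := by
  unfold dressedLiftVec liftVec
  rw [ins_flowLiftAt_lincomb hφ 0 (flowTime β L) a b hf hh,
    iterate_transferApply_lincomb β (OpPlat.isPhys_ins hφ (isPhys_flowLiftAt 0 _ hf)) (OpPlat.isPhys_ins hφ (isPhys_flowLiftAt 0 _ hh))]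

/-- Bilinearity of the dressed form, left slot. [folklore] -/
theorem l2_dressedLiftVec_lincomb_left (β : ℝ) {φ : GaugeConfig 3 L SU2 → ℝ} (hφ : IsPhys φ) (a b : ℝ)
    {f h e : GaugeConfig 3 1 SU2 → ℝ} (hf : IsPhys f) (hh : IsPhys h) (he : IsPhys e) :
    l2 (dressedLiftVec β φ fun V => a * f V + b * h V) (dressedLiftVec β φ e) =
      a * l2 (dressedLiftVec β φ f) (dressedLiftVec β φ e) + b * l2 (dressedLiftVec β φ h) (dressedLiftVec β φ e) := by
  rw [dressedLiftVec_lincomb β hφ a b hf hh]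
  exact l2_lincomb_left' (isPhys_dressedLiftVec β hφ hf) (isPhys_dressedLiftVec β hφ hh) (isPhys_dressedLiftVec β hφ he) a b

/-- Bilinearity of the dressed form, right slot. [folklore] -/
theorem l2_dressedLiftVec_lincomb_right (β : ℝ) {φ : GaugeConfig 3 L SU2 → ℝ} (hφ : IsPhys φ) (a b : ℝ)
    {f h e : GaugeConfig 3 1 SU2 → ℝ} (hf : IsPhys f) (hh : IsPhys h) (he : IsPhys e) :
    l2 (dressedLiftVec β φ e) (dressedLiftVec β φ fun V => a * f V + b * h V) =
      a * l2 (dressedLiftVec β φ e) (dressedLiftVec β φ f) + b * l2 (dressedLiftVec β φ e) (dressedLiftVec β φ h) := by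
  rw [l2_comm, l2_dressedLiftVec_lincomb_left β hφ a b hf hh he, l2_comm (dressedLiftVec β φ f), l2_comm (dressedLiftVec β φ h)]

end Dressed

/-! ## §3 ★ Symmetry zeros of the dressed covariance -/

section Zeros

variable {L : ℕ} [NeZero L]

/-- Averaging lemma, dressed: for weights `w` with `Σ_π w(π) h(P_π V) = 0` (all `V`) and any physical fine `X`,
`Σ_π w(π) ⟨X, u'_{h∘P_π}⟩ = 0` (move `K_β^m` to `X` by symmetry, expand `ins`, and average inside the integral:
`sum_weight_l2_flowLiftAt_eq_zero`). [folklore] -/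
theorem sum_weight_l2_dressedLiftVec_eq_zero (β : ℝ) {φ X : GaugeConfig 3 L SU2 → ℝ} (hφ : IsPhys φ) (hX : IsPhys X)
    {h : GaugeConfig 3 1 SU2 → ℝ} (hh : IsPhys h) (w : Equiv.Perm (Fin 3) → ℝ)
    (hsum : ∀ V, ∑ π : Equiv.Perm (Fin 3), w π * h (configPerm π V) = 0) :
    ∑ π : Equiv.Perm (Fin 3), w π * l2 X (dressedLiftVec β φ fun V => h (configPerm π V)) = 0 := by
  set t : ℝ := flowTime β L with ht
  set m : ℕ := dressSteps L with hm
  set Y : GaugeConfig 3 L SU2 → ℝ := (transferApply β)^[m] X with hY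
  have hYp : IsPhys Y := isPhys_iterate_transferApply β hX m
  -- `⟨X, K^m u_{h_π}⟩ = ⟨Y, F_{h_π}·φ⟩ − vev(h_π)·⟨Y, φ⟩`
  have hterm : ∀ π : Equiv.Perm (Fin 3), l2 X (dressedLiftVec β φ fun V => h (configPerm π V)) =
      l2 Y (flowLiftAt 0 t (fun V => h (configPerm π V)) * φ) -
        l2 φ (flowLiftAt 0 t (fun V => h (configPerm π V)) * φ) * l2 Y φ := fun π => by
    have hF : IsPhys (flowLiftAt (L := L) 0 t fun V => h (configPerm π V)) := isPhys_flowLiftAt 0 t (hh.comp_configPerm π)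
    have hu : IsPhys (OpPlat.ins φ (flowLiftAt (L := L) 0 t fun V => h (configPerm π V))) := OpPlat.isPhys_ins hφ hF
    unfold dressedLiftVec liftVec
    rw [← ht, ← hm]
    have h0 := l2_iterate_left_right β hX hu m 0
    simp only [Function.iterate_zero, id_eq, zero_add] at h0
    rw [h0, ← hY, OpPlat.ins_eq, l2_comm, sub_eq_add_neg, ← neg_smul,
      l2_add_left (OpPlat.isPhys_mul hF hφ) (hφ.smul _) hYp, l2_smul_left, l2_comm (flowLiftAt 0 t _ * φ), l2_comm φ Y]
    ring
  simp_rw [hterm, mul_sub, Finset.sum_sub_distrib]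
  have h1 := sum_weight_l2_flowLiftAt_eq_zero hφ hYp t hh w hsum
  have h2 := sum_weight_l2_flowLiftAt_eq_zero hφ hφ t hh w hsum
  have h3 : ∑ π : Equiv.Perm (Fin 3), w π * (l2 φ (flowLiftAt 0 t (fun V => h (configPerm π V)) * φ) * l2 Y φ) =
      (∑ π : Equiv.Perm (Fin 3), w π * l2 φ (flowLiftAt 0 t (fun V => h (configPerm π V)) * φ)) * l2 Y φ := by
    rw [Finset.sum_mul]
    exact Finset.sum_congr rfl fun π _ => by ring
  rw [h1, h3, h2, zero_mul, sub_zero]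

/-- ★ **SYMMETRY ZERO, dressed (invariant vs. non-invariant)**: `⟨u'_f, u'_h⟩ = 0` EXACTLY for a raw vacuum `φ`, an `S₃`-invariant physical
one-site `f` and a physical `h` of vanishing `S₃`-average. [cite: Luscher1983, §2] [cite: LuscherWolff1990] -/
theorem l2_dressedLiftVec_eq_zero_of_invariant (β : ℝ) {φ : GaugeConfig 3 L SU2 → ℝ} (hφ : IsPhys φ)
    (heig : transferApply β φ = levelValue su2Rep L β 0 • φ) {f h : GaugeConfig 3 1 SU2 → ℝ} (hf : IsPhys f) (hh : IsPhys h)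
    (hfinv : ∀ π : Equiv.Perm (Fin 3), (fun V => f (configPerm π V)) = f)
    (hhavg : ∀ V, ∑ π : Equiv.Perm (Fin 3), h (configPerm π V) = 0) :
    l2 (dressedLiftVec β φ f) (dressedLiftVec β φ h) = 0 := by
  have hcard : (Fintype.card (Equiv.Perm (Fin 3)) : ℝ) ≠ 0 := Nat.cast_ne_zero.mpr Fintype.card_ne_zero
  have hsum1 : ∀ V, ∑ π : Equiv.Perm (Fin 3), (1 : ℝ) * h (configPerm π V) = 0 := fun V => by simpa only [one_mul] using hhavg V
  have hπ : ∀ π : Equiv.Perm (Fin 3), l2 (dressedLiftVec β φ f) (dressedLiftVec β φ h) =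
      (1 : ℝ) * l2 (dressedLiftVec β φ f) (dressedLiftVec β φ fun V => h (configPerm π V)) := fun π => by
    rw [one_mul, ← l2_dressedLiftVec_comp_configPerm β hφ heig π f h, hfinv π]
  have hs := sum_weight_l2_dressedLiftVec_eq_zero β hφ (isPhys_dressedLiftVec β hφ hf) hh (fun _ => 1) hsum1
  rw [← Finset.sum_congr rfl fun π _ => hπ π, Finset.sum_const, Finset.card_univ, nsmul_eq_mul] at hs
  exact (mul_eq_zero.mp hs).resolve_left hcard

/-- ★ **SYMMETRY ZERO, dressed (sign type)**: `⟨u'_f, u'_h⟩ = 0` when `f ∘ P_π = sgn(π)·f` for all `π` and `Σ_π sgn(π)·h∘P_π = 0`.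
[cite: Luscher1983, §2] [cite: LuscherWolff1990] -/
theorem l2_dressedLiftVec_eq_zero_of_sign (β : ℝ) {φ : GaugeConfig 3 L SU2 → ℝ} (hφ : IsPhys φ)
    (heig : transferApply β φ = levelValue su2Rep L β 0 • φ) {f h : GaugeConfig 3 1 SU2 → ℝ} (hf : IsPhys f) (hh : IsPhys h)
    (hfsgn : ∀ π : Equiv.Perm (Fin 3), (fun V => f (configPerm π V)) = ((Equiv.Perm.sign π : ℤ) : ℝ) • f)
    (hhavg : ∀ V, ∑ π : Equiv.Perm (Fin 3), ((Equiv.Perm.sign π : ℤ) : ℝ) * h (configPerm π V) = 0) :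
    l2 (dressedLiftVec β φ f) (dressedLiftVec β φ h) = 0 := by
  have hcard : (Fintype.card (Equiv.Perm (Fin 3)) : ℝ) ≠ 0 := Nat.cast_ne_zero.mpr Fintype.card_ne_zero
  -- `u'_{sgn•f} = sgn•u'_f` (linearity with `b = 0`)
  have hlin : ∀ π : Equiv.Perm (Fin 3), dressedLiftVec β φ (fun V => f (configPerm π V)) = ((Equiv.Perm.sign π : ℤ) : ℝ) • dressedLiftVec β φ f := by
    intro π
    have hfun : (fun V => f (configPerm π V)) = fun V => ((Equiv.Perm.sign π : ℤ) : ℝ) * f V + 0 * f V := by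
      rw [hfsgn π]; funext V; simp only [Pi.smul_apply, smul_eq_mul, zero_mul, add_zero]
    rw [hfun, dressedLiftVec_lincomb β hφ _ 0 hf hf, zero_smul, add_zero]
  have hπ : ∀ π : Equiv.Perm (Fin 3), l2 (dressedLiftVec β φ f) (dressedLiftVec β φ h) =
      ((Equiv.Perm.sign π : ℤ) : ℝ) * l2 (dressedLiftVec β φ f) (dressedLiftVec β φ fun V => h (configPerm π V)) := fun π => by
    have hinv := l2_dressedLiftVec_comp_configPerm β hφ heig π f h
    rw [hlin π, l2_smul_left] at hinv
    -- hinv : sgn π * ⟨u'_f, u'_{h∘P}⟩ = ⟨u'_f, u'_h⟩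
    exact hinv.symm
  have hs := sum_weight_l2_dressedLiftVec_eq_zero β hφ (isPhys_dressedLiftVec β hφ hf) hh _ hhavg
  rw [← Finset.sum_congr rfl fun π _ => hπ π, Finset.sum_const, Finset.card_univ, nsmul_eq_mul] at hs
  exact (mul_eq_zero.mp hs).resolve_left hcard

end Zeros

end Summit.QuantumFields.YangMills.Theorems.FemtoTransferGap.PolyakovLift

end
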